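import Literature.Computability.AlgebraicComplexity.QuantumFunctionalsUpperProofs
import Literature.Computability.AlgebraicComplexity.QuantumFunctionalsUpperKroneckerRuleProofs
import Literature.Computability.AlgebraicComplexity.QuantumFunctionalsUpperKroneckerEntropyProofs
import HarnessLib

/-!
# Sub-multiplicativity of the upper quantum functional — discharge of
# `ChristandlVranaZuiddam2023_upper_submultiplicative` (CVZ Lemma 3.13)

Topic `Literature/Computability/AlgebraicComplexity`; proofs file (theorems only) closing the
decomposition of the named fact `ChristandlVranaZuiddam2023_upper_submultiplicative` of
`QuantumFunctionalsUpper.lean` (Christandl–Vrana–Zuiddam, *Universal points in the asymptotic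
spectrum of tensors*, J. Amer. Math. Soc. 36 (2023) = arXiv:1709.07851v3, Lemma 3.13, p. 14:
`F^θ(s ⊗ t) ≤ F^θ(s) F^θ(t)` for the upper quantum functional of Def. 3.3 and `θ ∈ P_nc(B)`, for
`k = 3` all of `P([3])`).

`QuantumFunctionalsUpperKronecker.lean` proved the printed proof as the reduction
`ChristandlVranaZuiddam2023_upper_submultiplicative_of_schurWeyl` to four printed ingredients,
each of which is now a theorem of the tree:

* Schur–Weyl vanishing (finiteness of the suprema `E^θ`): `schurWeyl_isotypicSum_eq_zero_holds`
  (`QuantumFunctionalsUpperProofs.lean`);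
* the isotypic decomposition (sw), `∑_λ P_λ = 1`: `sum_isotypicSum_eq_self_holds`
  (`QuantumFunctionalsUpperKroneckerProofs.lean`, from Serre §2.6 Thm. 8 for `𝔖ₙ`);
* the Kronecker restriction rule (before Lemma 3.13):
  `kroneckerCoeff_ne_zero_of_isotypicSum_outerPow_holds`
  (`QuantumFunctionalsUpperKroneckerRuleProofs.lean`, characters);
* Lemma 3.10.1, `g_{λμν} ≠ 0 ⇒ H(λ̄) ≤ H(μ̄) + H(ν̄)`:
  `ChristandlVranaZuiddam2023_entropy_le_of_kroneckerCoeff_holds`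
  (`QuantumFunctionalsUpperKroneckerEntropyProofs.lean`, dominance and Schur concavity).

Hence `ChristandlVranaZuiddam2023_upper_submultiplicative_holds`, and the logarithmic form
`E^θ(s ⊗ t) ≤ E^θ(s) + E^θ(t)` unconditionally (`upperLogQuantumFunctional_kroneckerTensor_le_holds`).

## Source

M. Christandl, P. Vrana, J. Zuiddam, J. Amer. Math. Soc. 36 (2023) 31–79 = arXiv:1709.07851v3,
§3.1, Lemma 3.13 and its proof (p. 14). [ChristandlVranaZuiddam2023]
-/

noncomputable section

namespace Literature.Computability.AlgebraicComplexity

universe u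

/-- **Discharge of `ChristandlVranaZuiddam2023_upper_submultiplicative` (CVZ Lemma 3.13)**:
`F^θ(s ⊗ t) ≤ F^θ(s) F^θ(t)` for every `θ ∈ P([3])` and all complex 3-tensors `s, t`, by the
printed proof (`ChristandlVranaZuiddam2023_upper_submultiplicative_of_schurWeyl`) fed with the
four discharged ingredients. [cite: ChristandlVranaZuiddam2023, Lemma 3.13] -/
theorem ChristandlVranaZuiddam2023_upper_submultiplicative_holds :
    ChristandlVranaZuiddam2023_upper_submultiplicative.{u} :=
  ChristandlVranaZuiddam2023_upper_submultiplicative_of_schurWeyl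
    schurWeyl_isotypicSum_eq_zero_holds sum_isotypicSum_eq_self_holds
    kroneckerCoeff_ne_zero_of_isotypicSum_outerPow_holds
    ChristandlVranaZuiddam2023_entropy_le_of_kroneckerCoeff_holds

/-- **`E^θ(s ⊗ t) ≤ E^θ(s) + E^θ(t)`** for `θ ≥ 0` and all complex 3-tensors (the logarithmic form
of Lemma 3.13, last sentence of its printed proof), unconditionally.
[cite: ChristandlVranaZuiddam2023, Lemma 3.13] -/
theorem upperLogQuantumFunctional_kroneckerTensor_le_holds {ι κ μ ι' κ' μ' : Type u} [Fintype ι]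
    [Fintype κ] [Fintype μ] [Fintype ι'] [Fintype κ'] [Fintype μ'] {θ : Fin 3 → ℝ}
    (hθ : ∀ j, 0 ≤ θ j) (s : ι → κ → μ → ℂ) (t : ι' → κ' → μ' → ℂ) :
    upperLogQuantumFunctional θ (kroneckerTensor s t) ≤
      upperLogQuantumFunctional θ s + upperLogQuantumFunctional θ t :=
  upperLogQuantumFunctional_kroneckerTensor_le schurWeyl_isotypicSum_eq_zero_holds
    sum_isotypicSum_eq_self_holds kroneckerCoeff_ne_zero_of_isotypicSum_outerPow_holds
    ChristandlVranaZuiddam2023_entropy_le_of_kroneckerCoeff_holds hθ s t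

end Literature.Computability.AlgebraicComplexity

end
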